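import Mathlib
import Summits.ValiantsHypothesis.ValiantsHypothesis.Theses.FeketeSOS
import Summits.ValiantsHypothesis.ValiantsHypothesis.Theorems.FeketeSOSSublinearShadowTrivialShadow
import Summits.ValiantsHypothesis.ValiantsHypothesis.Theorems.FeketeSOSSublinearShadowThreeSquares
import Summits.ValiantsHypothesis.ValiantsHypothesis.Theorems.FeketeSOSSublinearShadowWindowReduction

/-!
# `FeketeSOS.SublinearShadow` (stmt-ValiantsHypothesis-14990), line `Sketch` — REDUCTION TO THE FEW-SQUARES ORDER BUDGET

`sublinearShadow_of_orderBudgetFew`: the crux `SublinearShadow` follows from the ORDER BUDGET restricted to the only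
regime the line leaves open — representations `Σ_{i<s} c_i g_i² = F_p` over `ℂ` with `deg g_i ≤ p²`, support-sum `S`,
`S⁴ ≤ p³`, at least `3` squares, FEW squares (`(s+1)^B · S < 2p`) and PARETO-MINIMAL cost (no representation with
`≤ s` squares of degree `≤ p²` has smaller support-sum) — asking for a window model of order `v`, `2v + 2 ≤ (s+1)^B`, on
the representation's own supports (the hypothesis, stated inline; it is the open core of the crux, not a published
fact).  Proof (the line's composition, `A = B + 1`, threshold `max p₁ 257`): choose a Pareto-minimal representation
below the given one (`Nat.find` on the support-sum among representations with `≤ s` squares); it has `≥ 3` squares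
(`stub_threeSquares`); if `2p ≤ (s₀+1)^B · S₀` the universal two-square shadow over `ZMod p` (`stub_trivialShadow`,
support `≤ 2p`) is within budget; otherwise the hypothesis gives a window model and `shadow_of_window` the shadow.
-/

namespace Summit.ValiantsHypothesis.ValiantsHypothesis.Theorems.SublinearShadowSketch

open Polynomial Finset
open scoped BigOperators

-- `Summit.ValiantsHypothesis.ValiantsHypothesis.…` is the tree's mandated single-conjunct layout (Sub = Summit).
set_option linter.dupNamespace false

/-- **Crux ⟸ few-squares Pareto-minimal ORDER BUDGET.**  If every Pareto-minimal sublinear complex representation of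
`F_p` with `3 ≤ s` and `(s+1)^B·S < 2p` (`p` large) has a window model of order `v` with `2v+2 ≤ (s+1)^B` on its own
supports, then `FeketeSOS.SublinearShadow` holds (with `A = B + 1`). -/
theorem sublinearShadow_of_orderBudgetFew : (∃ B p₁ : ℕ, ∀ (p : ℕ) [Fact p.Prime], p₁ ≤ p → ∀ (s : ℕ) (c : Fin s → ℂ) (g : Fin s → Polynomial ℂ), (∀ i, (g i).natDegree ≤ p ^ 2) → (∑ i, (g i).support.card) ^ 4 ≤ p ^ 3 → (∑ i, Polynomial.C (c i) * g i ^ 2) = ∑ m ∈ Finset.range p, Polynomial.C ((legendreSym p m : ℤ) : ℂ) * Polynomial.X ^ m → 3 ≤ s → (s + 1) ^ B * (∑ i, (g i).support.card) < 2 * p → (∀ (s' : ℕ) (c' : Fin s' → ℂ) (g' : Fin s' → Polynomial ℂ), s' ≤ s → (∀ i, (g' i).natDegree ≤ p ^ 2) → (∑ i, Polynomial.C (c' i) * g' i ^ 2) = ∑ m ∈ Finset.range p, Polynomial.C ((legendreSym p m : ℤ) : ℂ) * Polynomial.X ^ m → (∑ i, (g i).support.card) ≤ ∑ i, (g' i).support.card)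 → ∃ (v : ℕ) (K : Type) (_ : Field K) (_ : CharP K p) (_ : IsAlgClosed K) (γ : Fin s → Polynomial K) (Y : Fin s → Polynomial (Polynomial K)) (u₀ : K), 2 * v + 2 ≤ (s + 1) ^ B ∧ u₀ ≠ 0 ∧ (∀ i, (γ i).natDegree ≤ v) ∧ (∀ i, (Y i).natDegree ≤ v) ∧ (∀ i n, ((Y i).coeff n).support ⊆ (g i).support) ∧ (∑ i, (γ i).map (Polynomial.C : K →+* Polynomial K) * Y i ^ 2).coeff v = Polynomial.C u₀ * ∑ m ∈ Finset.range p, Polynomial.C ((legendreSym p m : ℤ) : K) * Polynomial.X ^ m) → Summit.ValiantsHypothesis.ValiantsHypothesis.Theses.FeketeSOS.SublinearShadow := by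
  intro hOB
  unfold Summit.ValiantsHypothesis.ValiantsHypothesis.Theses.FeketeSOS.SublinearShadow
  obtain ⟨B, p₁, H⟩ := hOB
  refine ⟨B + 1, max p₁ 257, ?_⟩
  intro p _ hp s c g hdeg hS hrep
  classical
  have hprime : p.Prime := Fact.out
  have hp₁ : p₁ ≤ p := le_trans (le_max_left _ _) hp
  have hp257 : 257 ≤ p := le_trans (le_max_right _ _) hp
  have hp2 : p ≠ 2 := by omega
  -- Step 0: a Pareto-minimal representation below `(s, c, g)`
  set Srep : ℕ := ∑ i, (g i).support.card with hSrep
  have hex : ∃ n, ∃ (s' : ℕ) (c' : Fin s' → ℂ) (g' : Fin s' → Polynomial ℂ), s' ≤ s ∧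
      (∀ i, (g' i).natDegree ≤ p ^ 2) ∧
      (∑ i, Polynomial.C (c' i) * g' i ^ 2)
        = ∑ m ∈ Finset.range p, Polynomial.C ((legendreSym p m : ℤ) : ℂ) * Polynomial.X ^ m ∧
      (∑ i, (g' i).support.card) = n := ⟨Srep, s, c, g, le_rfl, hdeg, hrep, rfl⟩
  obtain ⟨s₀, c₀, g₀, hs₀, hdeg₀, hrep₀, hS₀⟩ := Nat.find_spec hex
  have hmin₀ : ∀ (s' : ℕ) (c' : Fin s' → ℂ) (g' : Fin s' → Polynomial ℂ), s' ≤ s →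
      (∀ i, (g' i).natDegree ≤ p ^ 2) →
      (∑ i, Polynomial.C (c' i) * g' i ^ 2)
        = ∑ m ∈ Finset.range p, Polynomial.C ((legendreSym p m : ℤ) : ℂ) * Polynomial.X ^ m →
      Nat.find hex ≤ ∑ i, (g' i).support.card :=
    fun s' c' g' hs' hdeg' hrep' => Nat.find_min' hex ⟨s', c', g', hs', hdeg', hrep', rfl⟩
  set S₀ : ℕ := ∑ i, (g₀ i).support.card with hS₀def
  have hS₀le : S₀ ≤ Srep := by rw [hS₀]; exact hmin₀ s c g le_rfl hdeg hrep
  have hS₀4 : S₀ ^ 4 ≤ p ^ 3 := le_trans (Nat.pow_le_pow_left hS₀le 4) hS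
  have hmin : ∀ (s' : ℕ) (c' : Fin s' → ℂ) (g' : Fin s' → Polynomial ℂ), s' ≤ s₀ →
      (∀ i, (g' i).natDegree ≤ p ^ 2) →
      (∑ i, Polynomial.C (c' i) * g' i ^ 2)
        = ∑ m ∈ Finset.range p, Polynomial.C ((legendreSym p m : ℤ) : ℂ) * Polynomial.X ^ m →
      S₀ ≤ ∑ i, (g' i).support.card := fun s' c' g' hs' hdeg' hrep' => by
    rw [hS₀]; exact hmin₀ s' c' g' (hs'.trans hs₀) hdeg' hrep'
  -- Step 1: at least three squares
  have h3 : 3 ≤ s₀ := stub_threeSquares p hp257 s₀ c₀ g₀ hS₀4 hrep₀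
  have hs1 : (s₀ + 1) ^ B ≤ (s + 1) ^ B := Nat.pow_le_pow_left (Nat.succ_le_succ hs₀) B
  have hsB : (s + 1) ^ B ≤ (s + 1) ^ (B + 1) := Nat.pow_le_pow_right (Nat.succ_pos s) (Nat.le_succ B)
  by_cases hmany : 2 * p ≤ (s₀ + 1) ^ B * S₀
  · -- Step 2a: many squares — the trivial two-square shadow over `ZMod p`
    obtain ⟨c', g', hdeg', hcard', hrep'⟩ := stub_trivialShadow p hp2
    refine ⟨ZMod p, inferInstance, inferInstance, 2, c', g', ?_, hdeg', ?_, ?_⟩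
    · calc 2 ≤ s₀ + 1 := by omega
        _ ≤ (s₀ + 1) ^ (B + 1) := Nat.le_self_pow (Nat.succ_ne_zero B) _
        _ ≤ (s + 1) ^ (B + 1) := Nat.pow_le_pow_left (Nat.succ_le_succ hs₀) (B + 1)
    · calc ∑ j, (g' j).support.card ≤ 2 * p := hcard'
        _ ≤ (s₀ + 1) ^ B * S₀ := hmany
        _ ≤ (s + 1) ^ (B + 1) * Srep := Nat.mul_le_mul (hs1.trans hsB) hS₀le
    · rw [hrep', sub_self]; exact dvd_zero _
  · -- Step 2b: few squares — ORDER BUDGET + window reduction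
    push Not at hmany
    obtain ⟨v, K, instF, instC, instA, γ, Y, u₀, hv, hu, hγ, hY, hsupp, hlayer⟩ :=
      H p hp₁ s₀ c₀ g₀ hdeg₀ hS₀4 hrep₀ h3 hmany hmin
    obtain ⟨d, c', g', hd, hdeg', hcard, hdvd⟩ :=
      shadow_of_window p K s₀ v (fun i => (g₀ i).support) γ Y u₀ hu hγ hY hsupp hlayer
    refine ⟨K, instF, instC, d, c', g', ?_, hdeg', ?_, hdvd⟩
    · calc d ≤ (2 * v + 2) * s₀ := hd
        _ ≤ (s₀ + 1) ^ B * (s₀ + 1) := Nat.mul_le_mul hv (Nat.le_succ s₀)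
        _ = (s₀ + 1) ^ (B + 1) := (pow_succ _ _).symm
        _ ≤ (s + 1) ^ (B + 1) := Nat.pow_le_pow_left (Nat.succ_le_succ hs₀) (B + 1)
    · calc ∑ j, (g' j).support.card ≤ (2 * v + 2) * S₀ := hcard
        _ ≤ (s₀ + 1) ^ B * S₀ := Nat.mul_le_mul_right _ hv
        _ ≤ (s + 1) ^ (B + 1) * Srep := Nat.mul_le_mul (hs1.trans hsB) hS₀le

end Summit.ValiantsHypothesis.ValiantsHypothesis.Theorems.SublinearShadowSketch
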